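import Literature.AlgebraicTopology.Homotopy.FibreBundles
import Literature.AlgebraicTopology.SingularHomology.CohomologyHomotopyInvariance
import Mathlib.Topology.Connected.LocallyPathConnected
import HarnessLib

/-!
# Fibrewise spanning by global classes propagates over a connected base

Topic `Literature/AlgebraicTopology/Homotopy`. For a locally trivial fibration `p : E → B`
(Bröcker–Jänich (8.12), `IsLocallyTrivialFibration`) and global classes `ζ_i ∈ Hⁿ(E; K)`, the
restrictions `ζ_i|_{p⁻¹(b)}` form, as `b` varies, a family of sections of the local system
`b ↦ Hⁿ(p⁻¹(b); K)`; over a trivialising neighbourhood `U × p⁻¹(b) ≅ p⁻¹(U)` the fibre inclusions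
at two points joined by a path in `U` are homotopic, so the restricted classes correspond under
the fibre homeomorphisms (homotopy invariance of cohomology, Hatcher §3.1 p. 201). Consequently
the set of `b` at which the `ζ_i|_{p⁻¹(b)}` SPAN `Hⁿ(p⁻¹(b); K)` is open and closed, and over a
connected, locally path-connected base spanning at one fibre gives spanning at every fibre
(`IsLocallyTrivialFibration.span_map_fibre_eq_top`). This is the Leray-free form of the step
"`[𝒵_1], …, [𝒵_N]` gives a basis of `R²f_*ℚ`" in D. Arapura, *Hodge cycles and the Leray
filtration*, Pacific J. Math. **319** (2022), proof of Cor. 1.5 (the classes span `H²` of ONE fibre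
by the Lefschetz `(1,1)` theorem, hence of every fibre). Everything is proved; no definition and
no named fact is introduced (D-0026).

## References

* D. Arapura, *Hodge cycles and the Leray filtration*, Pacific J. Math. 319 (2022) 233–258,
  proof of Cor. 1.5. [Arapura2022]
* A. Hatcher, *Algebraic Topology*, CUP (2002), §3.1 p. 201 (homotopy invariance), §4.2 p. 376
  (fibre bundles). [HatcherAT2002]
* Th. Bröcker, K. Jänich, *Introduction to Differential Topology*, CUP (1982), (8.12).
  [BrockerJanichIDT1982]
-/

noncomputable section

open Set Function CategoryTheory Topology Filter
open Literature.AlgebraicTopology.SingularHomology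

namespace Literature.AlgebraicTopology.Homotopy

universe u v w

variable (K : Type w) [CommRing K] {E : Type u} {B : Type v} [TopologicalSpace E]
  [TopologicalSpace B] {p : E → B}

/-- Over a trivialising neighbourhood `U` of `b`, the fibre `p⁻¹(b')`, `b' ∈ U`, is homeomorphic to
`p⁻¹(b)` by `x ↦ φ(b', x)`. [cite: BrockerJanichIDT1982, (8.12)] -/
theorem exists_fibre_homeomorph_of_trivialisation {b : B} {U : Set B}
    (φ : ↥U × ↥(p ⁻¹' {b}) ≃ₜ ↥(p ⁻¹' U)) (hφ : ∀ x : ↥U × ↥(p ⁻¹' {b}), p (φ x) = x.1)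
    {b' : B} (hb' : b' ∈ U) :
    ∃ e : ↥(p ⁻¹' {b}) ≃ₜ ↥(p ⁻¹' {b'}), ∀ x, (e x : E) = φ (⟨b', hb'⟩, x) := by
  have hmem : ∀ z : ↥(p ⁻¹' {b'}), (z : E) ∈ p ⁻¹' U := fun z ↦ by
    have hz : p z = b' := z.2
    show p z ∈ U
    rw [hz]; exact hb'
  have hfst : ∀ z : ↥(p ⁻¹' {b'}), (φ.symm ⟨z, hmem z⟩).1 = ⟨b', hb'⟩ := fun z ↦ by
    apply Subtype.ext
    have h := hφ (φ.symm ⟨z, hmem z⟩)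
    rw [Homeomorph.apply_symm_apply] at h
    have hz : p z = b' := z.2
    exact h.symm.trans hz
  have hinv : ∀ w : ↥(p ⁻¹' {b}), p ((φ (⟨b', hb'⟩, w) : ↥(p ⁻¹' U)) : E) = b' := fun w ↦ hφ _
  refine ⟨⟨⟨fun w => ⟨(φ (⟨b', hb'⟩, w) : ↥(p ⁻¹' U)), hinv w⟩, fun z => (φ.symm ⟨z, hmem z⟩).2,
    fun w => ?_, fun z => ?_⟩, ?_, ?_⟩, fun w => rfl⟩
  · have hι : (⟨((φ (⟨b', hb'⟩, w) : ↥(p ⁻¹' U)) : E), hmem ⟨_, hinv w⟩⟩ : ↥(p ⁻¹' U)) =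
        φ (⟨b', hb'⟩, w) := Subtype.ext rfl
    show (φ.symm ⟨((φ (⟨b', hb'⟩, w) : ↥(p ⁻¹' U)) : E), hmem ⟨_, hinv w⟩⟩).2 = w
    rw [hι, Homeomorph.symm_apply_apply]
  · apply Subtype.ext
    have hpair : ((⟨b', hb'⟩ : ↥U), (φ.symm ⟨z, hmem z⟩).2) = φ.symm ⟨z, hmem z⟩ :=
      Prod.ext (hfst z).symm rfl
    show ((φ (⟨b', hb'⟩, (φ.symm ⟨z, hmem z⟩).2) : ↥(p ⁻¹' U)) : E) = z
    rw [hpair, Homeomorph.apply_symm_apply]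
  · exact (continuous_subtype_val.comp
      (φ.continuous.comp (continuous_const.prodMk continuous_id))).subtype_mk _
  · exact (continuous_snd.comp φ.symm.continuous).comp (continuous_subtype_val.subtype_mk _)

variable {K} in
/-- Spanning families stay spanning under a surjective linear map. [folklore] -/
private theorem span_range_comp_eq_top {M N : Type*} [AddCommGroup M] [Module K M]
    [AddCommGroup N] [Module K N] {ι : Type*} {v : ι → M} (f : M →ₗ[K] N) (hf : Surjective f)
    (hv : Submodule.span K (Set.range v) = ⊤) : Submodule.span K (Set.range (f ∘ v)) = ⊤ := by
  rw [Set.range_comp, Submodule.span_image, hv, Submodule.map_top, LinearMap.range_eq_top.2 hf]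

/-- Over a trivialising neighbourhood `U` of `b`, for `b' ∈ U`: the restrictions `ζ_i|_{p⁻¹(b')}`
span `Hⁿ(p⁻¹(b'); K)` iff the pull-backs of the `ζ_i` along the fibre inclusion
`x ↦ φ(b', x) : p⁻¹(b) → E` span `Hⁿ(p⁻¹(b); K)` (the inclusion is the fibre homeomorphism
followed by `p⁻¹(b') ⊆ E`). [cite: HatcherAT2002, §3.1 (induced homomorphisms)] -/
theorem span_map_fibre_eq_top_iff_of_trivialisation {b : B} {U : Set B}
    (φ : ↥U × ↥(p ⁻¹' {b}) ≃ₜ ↥(p ⁻¹' U)) (hφ : ∀ x : ↥U × ↥(p ⁻¹' {b}), p (φ x) = x.1)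
    {b' : B} (hb' : b' ∈ U) {n : ℕ} {ι : Type*} (ζ : ι → singularCohomology K K E n) :
    Submodule.span K (Set.range fun i =>
        singularCohomology.map K K (subsetIncl (p ⁻¹' {b'})) n (ζ i)) = ⊤ ↔
      Submodule.span K (Set.range fun i => singularCohomology.map K K
        (⟨fun x => ((φ (⟨b', hb'⟩, x) : ↥(p ⁻¹' U)) : E), continuous_subtype_val.comp
          (φ.continuous.comp (continuous_const.prodMk continuous_id))⟩ : C(↥(p ⁻¹' {b}), E))
        n (ζ i)) = ⊤ := by
  obtain ⟨e, he⟩ := exists_fibre_homeomorph_of_trivialisation φ hφ hb'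
  have hcomp : (subsetIncl (p ⁻¹' {b'})).comp (e : C(↥(p ⁻¹' {b}), ↥(p ⁻¹' {b'}))) =
      (⟨fun x => ((φ (⟨b', hb'⟩, x) : ↥(p ⁻¹' U)) : E), continuous_subtype_val.comp
        (φ.continuous.comp (continuous_const.prodMk continuous_id))⟩ : C(↥(p ⁻¹' {b}), E)) :=
    ContinuousMap.ext fun x => he x
  have hfac : ∀ i, singularCohomology.map K K
      (⟨fun x => ((φ (⟨b', hb'⟩, x) : ↥(p ⁻¹' U)) : E), continuous_subtype_val.comp
        (φ.continuous.comp (continuous_const.prodMk continuous_id))⟩ : C(↥(p ⁻¹' {b}), E))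
        n (ζ i) =
      singularCohomology.map K K (e : C(↥(p ⁻¹' {b}), ↥(p ⁻¹' {b'}))) n
        (singularCohomology.map K K (subsetIncl (p ⁻¹' {b'})) n (ζ i)) := fun i => by
    rw [← hcomp, singularCohomology.map_comp, ModuleCat.comp_apply]
  simp_rw [hfac]
  constructor
  · intro h
    exact span_range_comp_eq_top (v := fun i =>
        singularCohomology.map K K (subsetIncl (p ⁻¹' {b'})) n (ζ i))
      (singularCohomology.mapIso K K e n).toLinearEquiv.toLinearMap
      (singularCohomology.mapIso K K e n).toLinearEquiv.surjective h
  · intro h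
    have h' := span_range_comp_eq_top (singularCohomology.mapIso K K e n).symm.toLinearEquiv.toLinearMap
      (singularCohomology.mapIso K K e n).symm.toLinearEquiv.surjective h
    convert h' using 3
    refine funext fun i => ?_
    change _ = ((singularCohomology.mapIso K K e n).hom ≫ (singularCohomology.mapIso K K e n).inv) _
    rw [Iso.hom_inv_id]
    rfl

/-- **Fibrewise spanning propagates over a connected base.** Let `p : E → B` be a locally
trivial fibration over a preconnected, locally path-connected base and `ζ_i ∈ Hⁿ(E; K)` global
classes. If the restrictions `ζ_i|_{p⁻¹(b₀)}` span `Hⁿ(p⁻¹(b₀); K)` for ONE `b₀`, they span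
`Hⁿ(p⁻¹(b); K)` for every `b`: over a trivialising `U × p⁻¹(b) ≅ p⁻¹(U)` the fibre inclusions at
two points joined by a path in `U` are homotopic, hence induce the same map on cohomology
(Hatcher §3.1 p. 201), so the spanning locus is open and closed. (The sections `b ↦ ζ_i|_{p⁻¹(b)}`
of the local system `Rⁿp_*K` are locally constant: "`[𝒵_1], …, [𝒵_N]` gives a basis of
`R²f_*ℚ`", Arapura 2022, proof of Cor. 1.5.) [cite: Arapura2022, proof of Cor. 1.5 (p. 5)]
[cite: HatcherAT2002, §3.1 p. 201 and §4.2 p. 376] [cite: BrockerJanichIDT1982, (8.12)] -/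
theorem IsLocallyTrivialFibration.span_map_fibre_eq_top [PreconnectedSpace B]
    [LocallyPathConnectedSpace B] (hp : IsLocallyTrivialFibration p) {n : ℕ} {ι : Type*}
    (ζ : ι → singularCohomology K K E n) {b₀ : B}
    (h₀ : Submodule.span K (Set.range fun i =>
      singularCohomology.map K K (subsetIncl (p ⁻¹' {b₀})) n (ζ i)) = ⊤) (b : B) :
    Submodule.span K (Set.range fun i =>
      singularCohomology.map K K (subsetIncl (p ⁻¹' {b})) n (ζ i)) = ⊤ := by
  -- the spanning locus
  set S : Set B := {b | Submodule.span K (Set.range fun i =>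
    singularCohomology.map K K (subsetIncl (p ⁻¹' {b})) n (ζ i)) = ⊤} with hS
  -- it is locally constant
  have key : ∀ b : B, ∃ W ∈ 𝓝 b, ∀ b' ∈ W, (b' ∈ S ↔ b ∈ S) := by
    intro b
    obtain ⟨U, hU, hbU, φ, hφ⟩ := hp b
    obtain ⟨W, ⟨hWn, hWpc⟩, hWU⟩ := (path_connected_basis b).mem_iff.1 (hU.mem_nhds hbU)
    refine ⟨W, hWn, fun b' hb' => ?_⟩
    obtain ⟨γ, hγ⟩ := hWpc.joinedIn b (mem_of_mem_nhds hWn) b' hb'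
    -- the fibre inclusions at `b` and `b'` through `φ` are homotopic
    set j : ↥U → C(↥(p ⁻¹' {b}), E) := fun c => ⟨fun x => ((φ (c, x) : ↥(p ⁻¹' U)) : E),
      continuous_subtype_val.comp (φ.continuous.comp (continuous_const.prodMk continuous_id))⟩
      with hj
    have hhom : (j ⟨b, hbU⟩).Homotopic (j ⟨b', hWU hb'⟩) := by
      refine ⟨{ toFun := fun tx => ((φ (⟨γ tx.1, hWU (hγ tx.1)⟩, tx.2) : ↥(p ⁻¹' U)) : E)
                continuous_toFun := ?_
                map_zero_left := fun x => ?_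
                map_one_left := fun x => ?_ }⟩
      · exact continuous_subtype_val.comp (φ.continuous.comp
          (((γ.continuous.comp continuous_fst).subtype_mk fun tx => hWU (hγ tx.1)).prodMk
            continuous_snd))
      · exact congrArg (fun c : ↥U => ((φ (c, x) : ↥(p ⁻¹' U)) : E)) (Subtype.ext γ.source)
      · exact congrArg (fun c : ↥U => ((φ (c, x) : ↥(p ⁻¹' U)) : E)) (Subtype.ext γ.target)
    have hmaps : ∀ i, singularCohomology.map K K (j ⟨b, hbU⟩) n (ζ i) =
        singularCohomology.map K K (j ⟨b', hWU hb'⟩) n (ζ i) := fun i => by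
      rw [singularCohomology.map_eq_of_homotopic' K K hhom n]
    change Submodule.span K _ = ⊤ ↔ Submodule.span K _ = ⊤
    rw [span_map_fibre_eq_top_iff_of_trivialisation K φ hφ (hWU hb') ζ,
      span_map_fibre_eq_top_iff_of_trivialisation K φ hφ hbU ζ]
    change Submodule.span K (Set.range fun i => singularCohomology.map K K (j ⟨b', hWU hb'⟩) n (ζ i))
        = ⊤ ↔
      Submodule.span K (Set.range fun i => singularCohomology.map K K (j ⟨b, hbU⟩) n (ζ i)) = ⊤
    simp_rw [hmaps]
  -- hence open and closed
  have hopen : IsOpen S := isOpen_iff_mem_nhds.2 fun b hb => by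
    obtain ⟨W, hWn, hW⟩ := key b
    exact mem_of_superset hWn fun b' hb' => (hW b' hb').2 hb
  have hclosed : IsClosed S := by
    rw [← isOpen_compl_iff]
    refine isOpen_iff_mem_nhds.2 fun b hb => ?_
    obtain ⟨W, hWn, hW⟩ := key b
    exact mem_of_superset hWn fun b' hb' hb'S => hb ((hW b' hb').1 hb'S)
  have huniv : S = univ := IsClopen.eq_univ ⟨hclosed, hopen⟩ ⟨b₀, h₀⟩
  have hb : b ∈ S := by rw [huniv]; exact mem_univ b
  exact hb

end Literature.AlgebraicTopology.Homotopy

end
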